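import Mathlib.GroupTheory.Torsion
import Literature.AlgebraicGeometry.Motives.AlgebraicEquivalence
import Literature.AlgebraicGeometry.Motives.BettiRealization
import Literature.AlgebraicTopology.SingularHomology.CapProduct
import Literature.AlgebraicTopology.SingularHomology.Orientation
import Literature.AlgebraicTopology.SingularHomology.FundamentalClass
import Literature.AlgebraicTopology.SingularHomology.PoincareDuality
import Literature.AlgebraicTopology.SingularHomology.Coefficients
import HarnessLib

-- provenance: harness21/H21/H21/Prelude/MotiveL/BettiCycleClass.lean @ 966583b (interim HEAD d8f2665); M5 mechanical rewrite
/-!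
# The Betti cycle class map and integral classes (trunk MotiveL, prelude C11)

For a smooth projective variety `X` over `ℂ` of dimension `n`, the **integral Betti cohomology**
`Hⁱ(X(ℂ); ℤ)` maps to the rational Betti cohomology `Hⁱ_B(X) = Hⁱ(X(ℂ); ℚ)` of
`Literature.Prelude.MotiveAbstract.BettiRealization` with kernel the torsion subgroup (universal
coefficients), `X(ℂ)` is a closed oriented topological `2n`-manifold (complex orientation), the
trace `H²ⁿ_B(X) → ℚ` is evaluation on the fundamental class `[X(ℂ)]`, and every algebraic cycle
of codimension `p` has an **integral cycle class** `cl_ℤ(Z) ∈ H²ᵖ(X(ℂ); ℤ)`, Poincaré dual to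
the push-forward of the fundamental class of (a resolution of) `Z`, refining the rational cycle
class of the Weil cohomology theory (Voisin, *Hodge Theory and Complex Algebraic Geometry I*
(2002), §11.1.2–11.1.4, Prop. 11.20; Fulton, *Intersection Theory* (1998), §19.1, Cor. 19.2;
Hatcher, *Algebraic Topology* (2002), §3.3).

Following the outline (MotiveL §C11 and review 12) these facts enter H21 as a **hypothesis
structure** `Literature.AlgebraicGeometry.Motives.BettiCycleData` extending the accepted `Literature.BettiHodgeData ℂ`; against it we
give *real* definitions of the group of **integral Hodge classes**
`Hdgᵖ(X, ℤ) = {x ∈ H²ᵖ(X(ℂ); ℤ) | x_ℚ ∈ Hᵖ,ᵖ}` and of the **integral Hodge conjecture**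
`IntegralHodgeConjectureFor` (a `Prop`; false in general: Atiyah–Hirzebruch 1962, Kollár 1992).
The Lefschetz `(1,1)` theorem (the case `p = 1` for the *classical* Betti realization) is stated
downstream as hodge.S13, `LefschetzOneOneStatement`, since it is not a consequence of the fields
of a general `B : BettiCycleData` (nothing pins `B.hodge` to the actual Hodge decomposition).

## Main definitions

* `Literature.bettiCohomologyInt X i := singularCohomology ℤ ℤ (ComplexPoints X) i` (G04), with
  `bettiCohomologyInt.map`; `Literature.torsionClasses X i := AddCommGroup.torsion _` (Mathlib).
* `Literature.AlgebraicGeometry.Motives.ClosedSubvariety.toSchemeOver`, `Literature.AlgebraicGeometry.Motives.ClosedSubvariety.ιOver`: a closed subvariety of a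
  `k`-scheme as a `k`-scheme.
* `Literature.AlgebraicGeometry.Motives.BettiCycleData`: `intToRat`, `intToRat_natural`, `intToRat_cup`, `intToRat_one`,
  `ker_intToRat`, `orientation`, `trace_intToRat`, `intCycleClass`, `intToRat_intCycleClass`,
  `intCycleClass_closedSubvariety`.
* `BettiHodgeData.cycleMap_mem_hodgeClasses`, `BettiHodgeData.chowGroupCycleMap_mem_hodgeClasses`
  (stated for any `BettiHodgeData k`, inherited by `BettiCycleData` through dot notation).
* `BettiCycleData.integralHodgeClasses`, `BettiCycleData.IntegralHodgeConjectureFor`,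
  `BettiCycleData.intCycleClass_mem_torsionClasses_of_mem_algTrivial` (the outline's
  `cycleMap_eq_zero_of_mem_algTrivial`, renamed after its statement; the `= 0` statement is the
  accepted `WeilCohomology.cycleMap_eq_zero_of_mem_algTrivial`).
* `PreWeilCohomology.hyperplaneClass W e H`, `PreWeilCohomology.hyperplanePow` (for any
  pre-Weil theory `W`), and the abbreviation `BettiCycleData.hyperplanePow B e H r`.

## Design notes

* Universe `0` and base field `ℂ` throughout the structure (outline §1(a): `ComplexPoints X : Type`
  forces it); the auxiliary `ClosedSubvariety.toSchemeOver` is universe polymorphic.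
* **G04 debt (review 12).** The comparison `Hⁱ(X(ℂ); ℤ) → Hⁱ(X(ℂ); ℚ)` is a change of
  *coefficient ring* (`singularCohomology ℤ ℤ → singularCohomology ℚ ℚ`), whereas the accepted
  G04 `singularCohomology.mapCoeff` only changes the coefficient *module* over a fixed ring
  (`Hⁱ(X; ℤ, ℤ) → Hⁱ(X; ℤ, ℚ)`); the identification `Hⁱ(X; ℤ, ℚ) = Hⁱ(X; ℚ, ℚ)` (restriction of
  scalars on cochains) is a G04-sized job. Hence `intToRat` is a FIELD of `BettiCycleData`,
  constrained by naturality, multiplicativity, unit, kernel (`ker_intToRat`, universal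
  coefficients, Hatcher Thm. 3.2) and the trace formula. The trace formula needs no ring change:
  G04's `kroneckerPairing ℤ ℚ : H²ⁿ(X; ℤ, ℤ) →ₗ H₂ₙ(X; ℤ, ℚ) →ₗ ℚ` is used with the image of
  `[X(ℂ)]` under `singularHomology.mapCoeff (ℤ → ℚ)`.
* No `algLeHom` field (review 13): "algebraically trivial ⇒ homologically trivial" is the
  hypothesis `B.W.AlgTrivialLeHomTrivial` of `intToRat_intCycleClass_eq_zero_of_mem_algTrivial`.
* `hyperplaneClass W e H := e* cl(H̄)` takes the point `H` of the ambient `ℙᴺ` (intended: the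
  generic point of a hyperplane, `Order.coheight H = 1`) as an *argument* rather than choosing
  one: no junk value, no dependence on a choice, and for `coheight H = 1` it is an
  `IsHyperplaneClass` (`isHyperplaneClass_hyperplaneClass`). Consequently `hyperplanePow` has
  arity `B.hyperplanePow e H r` (no `hX`, which was bookkeeping only in the outline's sketch).
* `IntegralHodgeConjectureFor B hX p` keeps the outline's arity by quantifying over the
  complementary dimension `d` with `p + d = n` (avoiding `n - p`); `intCycleClass hX h` takes
  `p d` implicitly (determined by `h : p + d = n`).
* `intCycleClass_closedSubvariety` takes the (derivable, `dim_eq_of_isSmoothProjective`)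
  hypothesis `hd : Z.dim = d` explicitly so that the structure's type is `sorry`-free.
* Mathlib has no Betti/singular cohomology of schemes, cycle class map or Hodge classes
  (searched `cycleClass`, `Betti`, `HodgeClass`, `fundamentalClass`: nothing relevant); we use
  Mathlib's `AddCommGroup.torsion`, `AddSubgroup.comap`, `AddMonoidHom.ker/range`, `Over.homMk`.

## References

* C. Voisin, *Hodge Theory and Complex Algebraic Geometry I*, CUP 2002, §7.1, §11.1, §11.3.
* W. Fulton, *Intersection Theory*, 2nd ed., Springer 1998, §19.1.
* A. Hatcher, *Algebraic Topology*, CUP 2002, §3.1 (Thm. 3.2), §3.3 (Thm. 3.26, 3.30).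
* M. Atiyah, F. Hirzebruch, *Analytic cycles on complex manifolds*, Topology 1 (1962).
* S. Lefschetz, *L'analysis situs et la géométrie algébrique* (1924); Griffiths–Harris, Ch. 1 §2.
-/

universe u v

open CategoryTheory AlgebraicGeometry Opposite

noncomputable section

namespace Literature.AlgebraicGeometry.Motives

/-! ### Integral Betti cohomology -/

/-- The **integral Betti cohomology** `Hⁱ(X(ℂ); ℤ)` of a scheme `X` over `ℂ`: singular
cohomology with integer coefficients of the complex points with the analytic topology
(Voisin I, §7.1.1 and §11.1.2; Hatcher §3.1). An `abbrev` for G04's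
`singularCohomology ℤ ℤ (ComplexPoints X) i`. [folklore] -/
abbrev bettiCohomologyInt (X : SchemeOver ℂ) (i : ℕ) : ModuleCat.{0} ℤ :=
  Literature.AlgebraicTopology.SingularHomology.singularCohomology ℤ ℤ (ComplexPoints X) i

/-- Pull-back `f* : Hⁱ(Y(ℂ); ℤ) ⟶ Hⁱ(X(ℂ); ℤ)` along a `ℂ`-morphism `f : X ⟶ Y`, induced by the
continuous map `f(ℂ)` (`AlgPoints.mapContinuous`; Hatcher §3.1). [folklore] -/
abbrev bettiCohomologyInt.map {X Y : SchemeOver ℂ} (f : X ⟶ Y) (i : ℕ) :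
    bettiCohomologyInt Y i ⟶ bettiCohomologyInt X i :=
  Literature.AlgebraicTopology.SingularHomology.singularCohomology.map ℤ ℤ (AlgPoints.mapContinuous (L := ℂ) f) i

/-- The **torsion classes** `Hⁱ(X(ℂ); ℤ)_tors`: Mathlib's torsion subgroup `AddCommGroup.torsion`
of the integral Betti cohomology (Voisin I, §11.1.2, Remark 11.17; Atiyah–Hirzebruch 1962). [cite: AtiyahHirzebruch1962] -/
abbrev torsionClasses (X : SchemeOver ℂ) (i : ℕ) : AddSubgroup (bettiCohomologyInt X i) :=
  AddCommGroup.torsion (bettiCohomologyInt X i)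

/-- For `X` smooth projective, `Hⁱ(X(ℂ); ℤ)` is a finitely generated abelian group (`X(ℂ)` is a
compact manifold, hence has the homotopy type of a finite CW complex; Hatcher, Cor. A.9 and
§3.1). Named fact (D-0014). [cite: HatcherAT2002, Cor. A.9 and §3.1] -/
def bettiCohomologyInt_finite : Prop :=
  ∀ ⦃n : ℕ⦄ ⦃X : SchemeOver ℂ⦄ (_hX : IsSmoothProjective n X) (i : ℕ),
    Module.Finite ℤ (bettiCohomologyInt X i)

/-! ### Closed subvarieties as schemes over the base -/

namespace ClosedSubvariety

variable {k : Type u} [Field k] {X : SchemeOver k} (Z : ClosedSubvariety X.left)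

/-- A closed subvariety `Z ⊆ X` of a `k`-scheme, regarded as a `k`-scheme via `Z ↪ X → Spec k`
(Hartshorne II.3, closed subschemes of schemes over a base). [folklore] -/
def toSchemeOver : SchemeOver k :=
  Over.mk (Z.ι ≫ X.hom)

/-- The closed immersion `Z ↪ X` of a closed subvariety as a morphism of `k`-schemes
(Hartshorne II.3). [folklore] -/
def ιOver : Z.toSchemeOver ⟶ X :=
  Over.homMk Z.ι rfl

/-- The underlying morphism of schemes of `Z.ιOver` is `Z.ι` (by definition of `Over.homMk`;
Hartshorne II.3). [folklore] -/
@[simp]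
lemma ιOver_left : Z.ιOver.left = Z.ι := rfl

/-- A closed subvariety which is smooth projective of dimension `d` over `k` has dimension `d`
as a subvariety, i.e. its generic point has height `d` in the specialisation order of `X`
(dimension theory of varieties: Hartshorne I.1.8A, II Ex. 3.20; Stacks 0A21). Named fact
(D-0014). [cite: Hartshorne1977, I.1.8A and II Ex. 3.20] -/
def dim_eq_of_isSmoothProjective : Prop :=
  ∀ ⦃d : ℕ⦄ (_hZ : IsSmoothProjective d Z.toSchemeOver), Z.dim = d

end ClosedSubvariety

/-! ### The Betti cycle-class data -/

/-- **Betti cycle-class data**: a hypothesis structure extending the Betti–Hodge realization data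
`BettiHodgeData ℂ` by the *integral structure* on Betti cohomology and the *integral cycle
class map*, standing in for the following theorems about smooth projective complex varieties
(Voisin, *Hodge Theory I*, §11.1.2–11.1.4 and Prop. 11.20; Fulton, *Intersection Theory*, §19.1,
Cor. 19.2; Hatcher §3.1 Thm. 3.2, §3.3 Thm. 3.26 and 3.30):
the comparison `Hⁱ(X(ℂ); ℤ) → Hⁱ(X(ℂ); ℚ)` is natural, multiplicative and unital with kernel the
torsion subgroup; `X(ℂ)` carries the complex orientation, and the trace of the Weil cohomology
theory is evaluation on its fundamental class; the cycle map `CH_d X → H²ᵖ_B(X)` lifts to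
`cl_ℤ : CH_d X →+ H²ᵖ(X(ℂ); ℤ)`, and for a smooth closed subvariety `Z ⊆ X` of dimension `d`,
`cl_ℤ [Z] ⌢ [X(ℂ)] = ι_* [Z(ℂ)]`. See the module docstring for why `intToRat` is a field
(G04 debt) and why there is no `algLeHom` field. [folklore] -/
structure BettiCycleData extends BettiHodgeData ℂ where
  /-- The comparison map `Hⁱ(X(ℂ); ℤ) →+ Hⁱ(X(ℂ); ℚ)` induced by `ℤ ⊆ ℚ` (Hatcher §3.1,
  change of coefficient ring; a field, see the module docstring). -/
  intToRat (X : SchemeOver ℂ) (i : ℕ) : bettiCohomologyInt X i →+ bettiCohomology X i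
  /-- `intToRat` is natural in `X`: it commutes with pull-backs `f(ℂ)*` (Hatcher §3.1). -/
  intToRat_natural : ∀ ⦃X Y : SchemeOver ℂ⦄ (f : X ⟶ Y) (i : ℕ) (x : bettiCohomologyInt Y i),
    intToRat X i (bettiCohomologyInt.map f i x) = bettiCohomology.map f i (intToRat Y i x)
  /-- `intToRat` is multiplicative for the cup products (Hatcher §3.2, Prop. 3.10 ff.). -/
  intToRat_cup : ∀ (X : SchemeOver ℂ) ⦃p q m : ℕ⦄ (h : p + q = m) (a : bettiCohomologyInt X p)
    (b : bettiCohomologyInt X q),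
    intToRat X m (Literature.AlgebraicTopology.SingularHomology.cupProduct h a b) = bettiCup h (intToRat X p a) (intToRat X q b)
  /-- `intToRat` carries `1 ∈ H⁰(X(ℂ); ℤ)` to `1 ∈ H⁰(X(ℂ); ℚ)` (Hatcher §3.2). -/
  intToRat_one : ∀ X : SchemeOver ℂ,
    intToRat X 0 (Literature.AlgebraicTopology.SingularHomology.singularCohomology.one ℤ (ComplexPoints X)) = bettiOne X
  /-- Universal coefficients: for `X` smooth projective (so that `H•(X(ℂ); ℤ)` is finitely
  generated) the kernel of `Hⁱ(X(ℂ); ℤ) → Hⁱ(X(ℂ); ℚ)` is the torsion subgroup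
  (Hatcher §3.1, Thm. 3.2 and Cor. 3.3; Voisin I, §11.1.2). -/
  ker_intToRat : ∀ ⦃n : ℕ⦄ ⦃X : SchemeOver ℂ⦄, IsSmoothProjective n X → ∀ i : ℕ,
    (intToRat X i).ker = torsionClasses X i
  /-- The complex orientation of `X(ℂ)`, a closed topological `2n`-manifold for `X` smooth
  projective of dimension `n` (Voisin I, §11.1.2; Hatcher §3.3, p. 235: a complex manifold is
  canonically `ℤ`-oriented). -/
  orientation : ∀ ⦃n : ℕ⦄ ⦃X : SchemeOver ℂ⦄, IsSmoothProjective n X →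
    Literature.AlgebraicTopology.SingularHomology.HomologicalOrientation ℤ (ComplexPoints X) (2 * n)
  /-- The trace `tr_X : H²ⁿ(X) → ℚ` of the Weil cohomology theory is evaluation on the
  fundamental class: `tr_X (iso⁻¹ x_ℚ) = ⟨x, [X(ℂ)]_ℚ⟩` for `x ∈ H²ⁿ(X(ℂ); ℤ)`, where `[X(ℂ)]_ℚ` is
  the image of the fundamental class in `H₂ₙ(X(ℂ); ℤ, ℚ)` (Voisin I, §11.1.2 and Thm. 11.24 ff.;
  Kleiman 1968 §1.2, Example (1); Hatcher §3.3). Stated with `(iso (2n)).inv.app (op X)`;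
  restated through `isoObj` in `BettiCycleData.trace_isoObj_symm_intToRat`, which is the form
  downstream statements should use. -/
  trace_intToRat : ∀ ⦃n : ℕ⦄ ⦃X : SchemeOver ℂ⦄ (hX : IsSmoothProjective n X)
    (x : bettiCohomologyInt X (2 * n)),
    W.trace X n (((iso (2 * n)).inv.app (op X)).hom (intToRat X (2 * n) x)) =
      Literature.AlgebraicTopology.SingularHomology.kroneckerPairing ℤ ℚ (ComplexPoints X) (2 * n) x
        (Literature.AlgebraicTopology.SingularHomology.singularHomology.mapCoeff (ComplexPoints X) (Int.castAddHom ℚ).toIntLinearMap (2 * n)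
          (orientation hX).fundamentalClass)
  /-- The **integral cycle class map** `cl_ℤ : CH_d X →+ H²ᵖ(X(ℂ); ℤ)`, `p + d = dim X`
  (Voisin I, §11.1.2, the class `[Z] ∈ H²ᵖ(X, ℤ)`; Fulton §19.1, `cl : A_k X → H_{2k} X` composed
  with Poincaré duality, Cor. 19.2). The indices `p d` are implicit (determined by `h`). -/
  intCycleClass : ∀ ⦃n : ℕ⦄ ⦃X : SchemeOver ℂ⦄, IsSmoothProjective n X → ∀ ⦃p d : ℕ⦄,
    p + d = n → (ChowGroup X.left d →+ bettiCohomologyInt X (2 * p))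
  /-- The integral cycle class refines the rational one: `(cl_ℤ c)_ℚ = iso (γ c)` where `γ` is
  the cycle map of the Weil cohomology theory `W` (Voisin I, §11.1.2; Fulton §19.1). The
  instance hypothesis `[CompactSpace X.left]` of `WeilCohomology.chowGroupCycleMap` is supplied,
  for smooth projective `X`, by the named fact `IsSmoothProjective.compactSpace` (`Varieties`). -/
  intToRat_intCycleClass : ∀ ⦃n : ℕ⦄ ⦃X : SchemeOver ℂ⦄ [CompactSpace X.left]
    (hX : IsSmoothProjective n X) ⦃p d : ℕ⦄ (h : p + d = n) (c : ChowGroup X.left d),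
    intToRat X (2 * p) (intCycleClass hX h c) =
      ((iso (2 * p)).hom.app (op X)).hom (W.chowGroupCycleMap hX h c)
  /-- For a smooth closed subvariety `Z ⊆ X` of dimension `d` (`hd`, derivable from `hZ` by
  `ClosedSubvariety.dim_eq_of_isSmoothProjective`; taken as a hypothesis to keep this type
  `sorry`-free), the integral class of `[Z]` is Poincaré dual to the push-forward of the
  fundamental class of `Z(ℂ)`: `cl_ℤ [Z] ⌢ [X(ℂ)] = ι(ℂ)_* [Z(ℂ)]` in `H_{2d}(X(ℂ); ℤ)`
  (Voisin I, §11.1.2, first construction; Fulton §19.1, `cl_X [V] = ι_* μ_V`). -/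
  intCycleClass_closedSubvariety : ∀ ⦃n : ℕ⦄ ⦃X : SchemeOver ℂ⦄ (hX : IsSmoothProjective n X)
    ⦃p d : ℕ⦄ (h : p + d = n) (Z : ClosedSubvariety X.left)
    (hZ : IsSmoothProjective d Z.toSchemeOver) (hd : Z.dim = d),
    Literature.AlgebraicTopology.SingularHomology.poincareDualityMap (orientation hX) (show 2 * p + 2 * d = 2 * n by omega)
        (intCycleClass hX h (ChowGroup.ofPoint Z.genericPoint hd)) =
      Literature.AlgebraicTopology.SingularHomology.singularHomology.map ℤ ℤ (AlgPoints.mapContinuous (L := ℂ) Z.ιOver) (2 * d)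
        (orientation hZ).fundamentalClass

namespace BettiHodgeData

variable {k : Type} [Field k] [Algebra k ℂ] (B : BettiHodgeData k)

/-- The inverse comparison `Hⁱ(X(ℂ); ℚ) → Hⁱ(X)` is the component of `(B.iso i).inv` at `X`
(by `rfl`; the comparison isomorphism of Voisin I, §7.1.1 / Kleiman 1968 §1.2). [cite: Kleiman1968, §1.2] -/
lemma isoObj_symm_apply (X : SchemeOver k) (i : ℕ) (a : bettiCohomology X i) :
    (B.isoObj X i).symm a = ((B.iso i).inv.app (op X)).hom a := rfl

variable {n : ℕ} {X : SchemeOver k}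

/-- The class `γ(c) ∈ H²ᵖ(X)` of any cycle `c` on a smooth projective `X` is a Hodge class
(Voisin I, Prop. 11.20; from `cycleClass_mem_hodgeClasses` and the vanishing of the junk
values `cycleClass_eq_zero_of_coheight_ne`). [folklore] -/
theorem cycleMap_mem_hodgeClasses (hX : IsSmoothProjective n X) (p : ℕ)
    (c : AlgebraicCycle X.left ℤ) :
    B.W.cycleMap X p c ∈ (B.hodge hX (2 * p)).hodgeClasses p := by
  change (∑ᶠ z, c z • B.W.cycleClass X p z) ∈ (B.hodge hX (2 * p)).hodgeClasses p
  refine finsum_induction (fun x ↦ x ∈ (B.hodge hX (2 * p)).hodgeClasses p) (zero_mem _)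
    (fun _ _ hx hy ↦ add_mem hx hy) fun z ↦ ?_
  by_cases hz : Order.coheight z = p
  · exact Submodule.smul_of_tower_mem _ (c z) (B.cycleClass_mem_hodgeClasses hX p z hz)
  · rw [B.W.cycleClass_eq_zero_of_coheight_ne hX p z hz, smul_zero]
    exact zero_mem _

/-- The rational cycle class `γ [c] ∈ H²ᵖ(X)` of a Chow class is a Hodge class
(Voisin I, Prop. 11.20). [folklore] -/
theorem chowGroupCycleMap_mem_hodgeClasses [CompactSpace X.left] (hX : IsSmoothProjective n X)
    {p d : ℕ}
    (h : p + d = n) (c : ChowGroup X.left d) :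
    B.W.chowGroupCycleMap hX h c ∈ (B.hodge hX (2 * p)).hodgeClasses p := by
  induction c using ChowGroup.induction_on with
  | h c =>
    rw [WeilCohomology.chowGroupCycleMap_mk]
    exact B.cycleMap_mem_hodgeClasses hX p c

end BettiHodgeData

/-! ### Hyperplane classes (for any pre-Weil cohomology theory) -/

namespace PreWeilCohomology

variable {k : Type u} [Field k] {K : Type v} [Field K] (W : PreWeilCohomology k K)
  {X : SchemeOver k}

/-- The **hyperplane class** `η = e* cl(H̄) ∈ H²(X)` of a projective embedding `e : X ↪ ℙᴺ`
with respect to a point `H` of `ℙᴺ` — intended: the generic point of a hyperplane,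
`Order.coheight H = 1` — namely the pull-back along `e` of the class of the prime cycle `H̄`
(Kleiman 1968 §1.4; Voisin I, §11.3.1). The divisor is an argument: no choice is made. If `H`
is the generic point of an irreducible hypersurface of degree `m`, the value is `m·η`, a positive
multiple of the hyperplane class (still an `IsHyperplaneClass`,
`isHyperplaneClass_hyperplaneClass`); if `Order.coheight H ≠ 1` the value is the junk value `0`
(accepted `cycleClass_eq_zero_of_coheight_ne`). [cite: Kleiman1968, §1.4] -/
def hyperplaneClass (e : ProjectiveEmbedding X) (H : (projectiveSpace e.n k).left) : W.obj X 2 :=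
  W.pullback e.ι 2 (W.cycleMap (projectiveSpace e.n k) 1 (primeCycle H))

/-- If `H` has codimension `1` in `ℙᴺ`, then `hyperplaneClass W e H` is a hyperplane class in the
sense of `PreWeilCohomology.IsHyperplaneClass` (Kleiman 1968 §1.4). [cite: Kleiman1968, §1.4] -/
theorem isHyperplaneClass_hyperplaneClass (e : ProjectiveEmbedding X)
    {H : (projectiveSpace e.n k).left} (hH : Order.coheight H = 1) :
    W.IsHyperplaneClass X (W.hyperplaneClass e H) := by
  refine ⟨e, primeCycle H, primeCycle_mem_cyclesOfCodim hH, ?_, rfl⟩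
  classical
  simp [primeCycle]

/-- The powers `ηʳ ∈ H²ʳ(X)` of the hyperplane class `η = hyperplaneClass W e H`
(Kleiman 1968 §1.4; used for Lefschetz-type statements). [cite: Kleiman1968, §1.4] -/
def hyperplanePow (e : ProjectiveEmbedding X) (H : (projectiveSpace e.n k).left) (r : ℕ) :
    W.obj X (2 * r) :=
  W.pow X (W.hyperplaneClass e H) r

/-- `η⁰ = 1` (Kleiman 1968 §1.4; by definition of `PreWeilCohomology.pow`). [cite: Kleiman1968, §1.4] -/
@[simp]
lemma hyperplanePow_zero (e : ProjectiveEmbedding X) (H : (projectiveSpace e.n k).left) :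
    W.hyperplanePow e H 0 = W.one X := rfl

/-- `ηʳ⁺¹ = ηʳ ∪ η` (Kleiman 1968 §1.4; by definition of `PreWeilCohomology.pow`). [cite: Kleiman1968, §1.4] -/
@[simp]
lemma hyperplanePow_succ (e : ProjectiveEmbedding X) (H : (projectiveSpace e.n k).left)
    (r : ℕ) :
    W.hyperplanePow e H (r + 1) = W.cup rfl (W.hyperplanePow e H r) (W.hyperplaneClass e H) :=
  rfl

end PreWeilCohomology

namespace BettiCycleData

variable (B : BettiCycleData) {n : ℕ} {X Y : SchemeOver ℂ}

/-! ### API restatements through `isoObj` -/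

/-- The trace formula of `BettiCycleData` through the linear equivalence `isoObj`:
`tr_X (isoObj⁻¹ x_ℚ) = ⟨x, [X(ℂ)]_ℚ⟩` (Voisin I, §11.1.2). [folklore] -/
theorem trace_isoObj_symm_intToRat (hX : IsSmoothProjective n X)
    (x : bettiCohomologyInt X (2 * n)) :
    B.W.trace X n ((B.isoObj X (2 * n)).symm (B.intToRat X (2 * n) x)) =
      Literature.AlgebraicTopology.SingularHomology.kroneckerPairing ℤ ℚ (ComplexPoints X) (2 * n) x
        (Literature.AlgebraicTopology.SingularHomology.singularHomology.mapCoeff (ComplexPoints X) (Int.castAddHom ℚ).toIntLinearMap (2 * n)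
          (B.orientation hX).fundamentalClass) :=
  B.trace_intToRat hX x

/-- `(cl_ℤ c)_ℚ = isoObj (γ c)` (Voisin I, §11.1.2; Fulton §19.1). [folklore] -/
theorem intToRat_intCycleClass' [CompactSpace X.left] (hX : IsSmoothProjective n X) {p d : ℕ}
    (h : p + d = n) (c : ChowGroup X.left d) :
    B.intToRat X (2 * p) (B.intCycleClass hX h c) =
      B.isoObj X (2 * p) (B.W.chowGroupCycleMap hX h c) :=
  B.intToRat_intCycleClass hX h c

/-- `isoObj⁻¹ (cl_ℤ c)_ℚ = γ c`: the rational cycle map of `W` is recovered from the integral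
one (Voisin I, §11.1.2). [folklore] -/
theorem isoObj_symm_intToRat_intCycleClass [CompactSpace X.left] (hX : IsSmoothProjective n X)
    {p d : ℕ}
    (h : p + d = n) (c : ChowGroup X.left d) :
    (B.isoObj X (2 * p)).symm (B.intToRat X (2 * p) (B.intCycleClass hX h c)) =
      B.W.chowGroupCycleMap hX h c := by
  rw [intToRat_intCycleClass', LinearEquiv.symm_apply_apply]

/-- Torsion classes die in rational cohomology: `x_ℚ = 0` for `x ∈ Hⁱ(X(ℂ); ℤ)_tors`
(any torsion element of the torsion-free group underlying a `ℚ`-vector space vanishes). [folklore] -/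
theorem intToRat_eq_zero_of_mem_torsionClasses {i : ℕ} {x : bettiCohomologyInt X i}
    (hx : x ∈ torsionClasses X i) : B.intToRat X i x = 0 := by
  have : IsAddTorsionFree (bettiCohomology X i) := .of_module_rat _
  exact (AddMonoidHom.isOfFinAddOrder (B.intToRat X i) hx).eq_zero'

/-- For `X` smooth projective, `x_ℚ = 0` iff `x` is torsion (universal coefficients;
Hatcher Thm. 3.2; field `ker_intToRat`). [folklore] -/
theorem intToRat_eq_zero_iff (hX : IsSmoothProjective n X) {i : ℕ} (x : bettiCohomologyInt X i) :
    B.intToRat X i x = 0 ↔ x ∈ torsionClasses X i := by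
  rw [← AddMonoidHom.mem_ker, B.ker_intToRat hX i]

/-! ### Integral Hodge classes and the integral Hodge conjecture -/

/-- The group of **integral Hodge classes** `Hdg²ᵖ(X, ℤ) ⊆ H²ᵖ(X(ℂ); ℤ)` of a smooth projective
`X`: the integral classes whose image in `H²ᵖ(X(ℂ); ℚ) ≅ H²ᵖ(X)` is a rational Hodge class,
i.e. lies in `Hᵖ,ᵖ` (Voisin I, §11.1.2 and Remark 11.17; Atiyah–Hirzebruch 1962). It contains
all torsion classes (`torsionClasses_le_integralHodgeClasses`). [cite: AtiyahHirzebruch1962] -/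
def integralHodgeClasses (hX : IsSmoothProjective n X) (p : ℕ) :
    AddSubgroup (bettiCohomologyInt X (2 * p)) :=
  (((B.hodge hX (2 * p)).hodgeClasses p).toAddSubgroup.comap
    (B.isoObj X (2 * p)).symm.toAddMonoidHom).comap (B.intToRat X (2 * p))

/-- Membership in `integralHodgeClasses`: `isoObj⁻¹ x_ℚ ∈ Hdgᵖ(X)` (Voisin I, §11.1.2). [folklore] -/
theorem mem_integralHodgeClasses_iff (hX : IsSmoothProjective n X) (p : ℕ)
    (x : bettiCohomologyInt X (2 * p)) :
    x ∈ B.integralHodgeClasses hX p ↔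
      (B.isoObj X (2 * p)).symm (B.intToRat X (2 * p) x) ∈
        (B.hodge hX (2 * p)).hodgeClasses p :=
  Iff.rfl

/-- Torsion classes are integral Hodge classes (their rational image is `0`; Voisin I,
Remark 11.17 — the source of the Atiyah–Hirzebruch counterexamples). [folklore] -/
theorem torsionClasses_le_integralHodgeClasses (hX : IsSmoothProjective n X) (p : ℕ) :
    torsionClasses X (2 * p) ≤ B.integralHodgeClasses hX p := by
  intro x hx
  rw [mem_integralHodgeClasses_iff, B.intToRat_eq_zero_of_mem_torsionClasses hx, map_zero]
  exact zero_mem _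

/-- Integral cycle classes are integral Hodge classes: `cl_ℤ(CH_d X) ⊆ Hdg²ᵖ(X, ℤ)`
(Voisin I, §11.1.2 and Prop. 11.20; the easy inclusion of the integral Hodge conjecture). [folklore] -/
theorem intCycleClass_mem_integralHodgeClasses [CompactSpace X.left]
    (hX : IsSmoothProjective n X) {p d : ℕ} (h : p + d = n) (c : ChowGroup X.left d) :
    B.intCycleClass hX h c ∈ B.integralHodgeClasses hX p := by
  rw [mem_integralHodgeClasses_iff, isoObj_symm_intToRat_intCycleClass]
  exact B.chowGroupCycleMap_mem_hodgeClasses hX h c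

/-- The image of the integral cycle class map lies in the integral Hodge classes
(Voisin I, §11.1.2). [folklore] -/
theorem range_intCycleClass_le [CompactSpace X.left] (hX : IsSmoothProjective n X) {p d : ℕ}
    (h : p + d = n) :
    (B.intCycleClass hX h).range ≤ B.integralHodgeClasses hX p := by
  rintro _ ⟨c, rfl⟩
  exact B.intCycleClass_mem_integralHodgeClasses hX h c

/-- The **integral Hodge conjecture** for `(X, p)`, relative to `B`: every integral Hodge class
in `H²ᵖ(X(ℂ); ℤ)` is the class of an algebraic cycle of dimension `d = dim X - p`,
`cl_ℤ(CH_d X) = Hdg²ᵖ(X, ℤ)` (Hodge 1950, original integral form; Voisin I, §11.1.2,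
Remark 11.17). The complementary dimension is quantified as `∀ d, p + d = n → …` (at most one
`d`; for `p > n` the statement is vacuous, as it should be since then `H²ᵖ(X(ℂ); ℤ) = 0`).
Since `range_intCycleClass_le` gives one inclusion for free, the conjecture is equivalent to the
inclusion `Hdg²ᵖ(X, ℤ) ⊆ cl_ℤ(CH_d X)` (`integralHodgeConjectureFor_iff`).
A `Prop`-valued definition: it is **false** in general (torsion counterexamples:
Atiyah–Hirzebruch, Topology 1 (1962); non-torsion: Kollár 1992). For the classical Betti
realization it holds for `p = 1` (Lefschetz `(1,1)` theorem, Voisin I, Thm. 11.30), but that is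
not a consequence of the fields of a general `B` (nothing pins `B.hodge` to the actual Hodge
decomposition), so it is *not* asserted here; it is stated downstream as hodge.S13
(`LefschetzOneOneStatement`). [cite: Hodge1950, original integral form] -/
def IntegralHodgeConjectureFor (hX : IsSmoothProjective n X) (p : ℕ) : Prop :=
  ∀ ⦃d : ℕ⦄ (h : p + d = n), (B.intCycleClass hX h).range = B.integralHodgeClasses hX p

/-- The integral Hodge conjecture for `(X, p)` is equivalent to the inclusions
`Hdg²ᵖ(X, ℤ) ⊆ cl_ℤ(CH_d X)` (the other inclusion is `range_intCycleClass_le`; Voisin I,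
§11.1.2). [folklore] -/
theorem integralHodgeConjectureFor_iff [CompactSpace X.left] (hX : IsSmoothProjective n X)
    (p : ℕ) :
    B.IntegralHodgeConjectureFor hX p ↔
      ∀ ⦃d : ℕ⦄ (h : p + d = n), B.integralHodgeClasses hX p ≤ (B.intCycleClass hX h).range :=
  forall₂_congr fun _ h ↦ ⟨fun e ↦ e.ge, fun e ↦ le_antisymm (B.range_intCycleClass_le hX h) e⟩

/-! ### Hyperplane classes -/

/-- The powers `ηʳ ∈ H²ʳ(X)` of the hyperplane class `η = e* cl(H̄)` of a projective embedding
`e : X ↪ ℙᴺ` and a point `H` of `ℙᴺ` (a hyperplane when `Order.coheight H = 1`), in the Weil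
cohomology theory underlying `B` (Kleiman 1968 §1.4; Voisin I, §11.3.1). An abbreviation for
`PreWeilCohomology.hyperplanePow` at `B.W`. [cite: Kleiman1968, §1.4] -/
abbrev hyperplanePow (e : ProjectiveEmbedding X) (H : (projectiveSpace e.n ℂ).left) (r : ℕ) :
    B.W.obj X (2 * r) :=
  B.W.hyperplanePow e H r

/-! ### Algebraic equivalence -/

/-- Under the hypothesis `B.W.AlgTrivialLeHomTrivial` (a theorem for the classical Betti
realization: Fulton §19.1, Ex. 19.1.11), the rational image of the integral class of an
algebraically trivial `d`-cycle vanishes: `(cl_ℤ [c])_ℚ = 0` (Voisin I, §11.1.2; Fulton §19.1;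
from the accepted `WeilCohomology.cycleMap_eq_zero_of_mem_algTrivial`). [folklore] -/
theorem intToRat_intCycleClass_eq_zero_of_mem_algTrivial [CompactSpace X.left]
    (hW : B.W.AlgTrivialLeHomTrivial) (hX : IsSmoothProjective n X) {p d : ℕ} (h : p + d = n) {c : ↥(cyclesOfDim X.left d)}
    (hc : (c : AlgebraicCycle X.left ℤ) ∈ algTrivial X d) :
    B.intToRat X (2 * p) (B.intCycleClass hX h (ChowGroup.mk X.left d c)) = 0 := by
  rw [intToRat_intCycleClass', WeilCohomology.chowGroupCycleMap_mk,
    WeilCohomology.cycleMap_eq_zero_of_mem_algTrivial hW hX h hc, map_zero]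

/-- Under `B.W.AlgTrivialLeHomTrivial`, the integral class of an algebraically trivial cycle on
a smooth projective `X` is a torsion class (Fulton §19.1 with universal coefficients; in fact it
is `0` integrally, Fulton Ex. 19.1.11, which is not derivable from the rational hypothesis).
This is the outline's `cycleMap_eq_zero_of_mem_algTrivial`, named after its statement. [folklore] -/
theorem intCycleClass_mem_torsionClasses_of_mem_algTrivial [CompactSpace X.left]
    (hW : B.W.AlgTrivialLeHomTrivial) (hX : IsSmoothProjective n X) {p d : ℕ} (h : p + d = n) {c : ↥(cyclesOfDim X.left d)}
    (hc : (c : AlgebraicCycle X.left ℤ) ∈ algTrivial X d) :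
    B.intCycleClass hX h (ChowGroup.mk X.left d c) ∈ torsionClasses X (2 * p) :=
  (B.intToRat_eq_zero_iff hX _).mp (B.intToRat_intCycleClass_eq_zero_of_mem_algTrivial hW hX h hc)

end BettiCycleData

end Literature.AlgebraicGeometry.Motives

end
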